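import Summits.QuantumFields.GaugeBoot.QuantitativeUnfreezing
import Summits.QuantumFields.GaugeBoot.PeriodicWordUpdate
import Summits.QuantumFields.GaugeBoot.DLRWilsonLoopStrict
import Summits.QuantumFields.GaugeBoot.ZdPlaquetteInsertion
import HarnessLib

/-!
# Gauge-boot: QUANTITATIVE UNFREEZING FOR EVERY LOOP READING SOME LINK EXACTLY ONCE — `e^{−4(d−1)N|β|} ≤ 1 ∓ ⟨W_x(w)⟩` in every
# DLR state at every real coupling (large-`N` supplement 20, part 3)

HONEST FRAMING (cell `pub-gaugeboot`, page 1 of every file): certified bounds on lattice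
expectations at STATED coupling, gauge group, dimension and torus size; NOT a mass gap, NOT a
continuum limit, NOT a string tension; NOT Yang–Mills-summit-bearing (barriers `FixedCouplingUltralocality`,
`PerturbativeInvisibility`).  An explicit (exponentially small) a-priori gap, uniform in the loop; it certifies no number of CERTIFIED.md.

## Content

Part 1 (`QuantitativeUnfreezing`) treated plaquettes; part 2 (`PeriodicWordUpdate`) shows that a word reading a link exactly once
is affine in that link variable with the trace form `Re tr ρ(hol(U[l ↦ h])) = Re tr ρ(h · staple)`.  Hence the Haar average over
that link of the loop variable vanishes, and part 1's quasi-invariance gives the gap for EVERY SUCH LOOP, uniformly in its length: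

* `integral_haar_wordLoopZd_update_mul_eq_zero` — `∫ W_x(w)(U[l ↦ gU_l]) dg = 0` when `(edgesRead zdUnit x w).count l = 1`
  (`ρ` without invariant vectors);
* ★★★ `IsHaarShiftState.exp_le_one_sub_integral_wordLoopZd` / `…_one_add_…` — for a probability Haar-shift state at ANY real `β`,
  EVERY base point `x` and EVERY word `w` reading some link `l` exactly once:
  **`e^{−|β|·2N·#{p ∋ l}} ≤ 1 − ∫ W_x(w) dμ`** and **`… ≤ 1 + ∫ W_x(w) dμ`**;
* ★★★ `exp_le_one_sub_integral_wordLoopZd_of_mem_ymGibbsMeasures_suN`, `abs_integral_wordLoopZd_le_of_mem_ymGibbsMeasures_suN` —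
  `SU(N)`, `N ≥ 2`, every real `β`, every DLR state, every such loop (all self-avoiding lattice loops, every rectangle, …):
  **`|∫ W_x(w) dμ| ≤ 1 − e^{−4(d−1)N|β|}`**, uniformly in the loop and in the state — supplement 16's strict unfreezing
  (`integral_wordLoopZd_lt_one_of_mem_ymGibbsMeasures`, a support argument) with an explicit rate.
[folklore] (quasi-invariance of Gibbs measures, Georgii 2011 §1.2–§2.1; Creutz's one-link heat bath, Phys. Rev. D 21 (1980) 2308.)
-/

noncomputable section

open MeasureTheory Function
open Literature.Probability.LatticeModels (Site)
open Literature.MathematicalPhysics.QuantumFieldTheory (haarProbability)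
open Literature.MathematicalPhysics.QuantumLattice
open Literature.RepresentationTheory.CompactGroups

namespace Summit.QuantumFields.GaugeBoot

variable {d N : ℕ} {G : Type} [Group G] [TopologicalSpace G] [IsTopologicalGroup G]
  [CompactSpace G] [MeasurableSpace G] [BorelSpace G] (ρ : G →* Matrix (Fin N) (Fin N) ℂ)

/-! ## The Haar average over a once-read link of a loop variable vanishes -/

omit [MeasurableSpace G] [BorelSpace G] in
/-- Trace form on `ℤ^d`: for a word reading `l` exactly once, `Re tr ρ(hol_x(w)(U[l ↦ h])) = Re tr ρ(h · staple(U))`. [folklore] -/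
theorem re_trace_wordHolonomyZd_update_eq (hρ : Continuous ρ) (x : Site d) (w : Word d) {l : ZdEdge d}
    (hl : (TiltedRP.Word.edgesRead (TiltedRP.zdUnit d) x w).count l = 1) (U : LGConfig d G) (h : G) :
    (ρ (wordHolonomyZd (Function.update U l h) x w)).trace.re =
      (ρ (h * (TiltedRP.Word.split (TiltedRP.zdUnit d) x w l hl).staple U)).trace.re := by
  rw [← TiltedRP.wordHolonomy_zdUnit]
  exact (TiltedRP.Word.split (TiltedRP.zdUnit d) x w l hl).re_trace_wordHolonomy_update ρ hρ U h

/-- ★ **The Haar average over a once-read link of the loop variable vanishes** (`ρ` without invariant vectors):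
`∫ W_x(w)(U[l ↦ gU_l]) dg = 0`. [folklore] -/
theorem integral_haar_wordLoopZd_update_mul_eq_zero (hρ : Continuous ρ)
    (hρ0 : ∀ m : G, ∫ g, ((ρ (g * m)).trace).re ∂(haarProbability G) = 0) (x : Site d) (w : Word d) {l : ZdEdge d}
    (hl : (TiltedRP.Word.edgesRead (TiltedRP.zdUnit d) x w).count l = 1) (U : LGConfig d G) :
    ∫ g, wordLoopZd ρ x w (Function.update U l (g * U l)) ∂(haarProbability G) = 0 := by
  simp only [wordLoopZd_apply, re_trace_wordHolonomyZd_update_eq ρ hρ x w hl, mul_assoc]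
  rw [integral_const_mul, hρ0, mul_zero]

/-! ## The gap for every loop reading a link exactly once -/

section Gap

variable [SecondCountableTopology G]

omit [CompactSpace G] [MeasurableSpace G] [BorelSpace G] [SecondCountableTopology G] in
/-- The loop variable shifted at one link, as a continuous function of `g`. [folklore] -/
theorem continuous_wordLoopZd_update (hρ : Continuous ρ) (x : Site d) (w : Word d) (l : ZdEdge d) (U : LGConfig d G) :
    Continuous fun g : G => wordLoopZd ρ x w (Function.update U l (g * U l)) :=
  (continuous_wordLoopZd hρ x w).comp (by
    refine continuous_pi fun y => ?_
    by_cases hy : y = l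
    · subst hy; simp only [Function.update_self]; exact continuous_id.mul continuous_const
    · simp only [Function.update_of_ne hy]; exact continuous_const)

/-- ★★★ **QUANTITATIVE UNFREEZING FOR LOOPS, UPPER SIDE**: for a probability Haar-shift state `μ` at ANY real `β` (`ρ` continuous
without invariant vectors), every base point `x` and every word `w` reading the link `l` exactly once:
`e^{−|β|·2N·#{p ∋ l}} ≤ 1 − ∫ W_x(w) dμ`. [folklore] -/
theorem IsHaarShiftState.exp_le_one_sub_integral_wordLoopZd (hρ : Continuous ρ)
    (hρ0 : ∀ m : G, ∫ g, ((ρ (g * m)).trace).re ∂(haarProbability G) = 0) {β : ℝ} {μ : Measure (LGConfig d G)}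
    [IsProbabilityMeasure μ] (hμ : IsHaarShiftState ρ β μ) (x : Site d) (w : Word d) {l : ZdEdge d}
    (hl : (TiltedRP.Word.edgesRead (TiltedRP.zdUnit d) x w).count l = 1) :
    Real.exp (-(|β| * (2 * N * (plaquettesTouching ({l} : Finset (ZdEdge d))).card))) ≤ 1 - ∫ U, wordLoopZd ρ x w U ∂μ := by
  set f : LGConfig d G → ℝ := fun U => 1 - wordLoopZd ρ x w U with hf
  obtain ⟨S, hS⟩ := isCylinder_one_sub_wordLoopZd (G := G) ρ x w
  have hWc : Continuous (wordLoopZd ρ x w) := continuous_wordLoopZd hρ x w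
  have hfc : Continuous f := continuous_const.sub hWc
  have hf0 : ∀ U, 0 ≤ f U := fun U =>
    sub_nonneg.2 ((le_abs_self _).trans (abs_wordLoopZd_le_one ρ hρ x w U))
  have havg : ∀ U, ∫ g, f (Function.update U l (g * U l)) ∂(haarProbability G) = 1 := by
    intro U
    simp only [hf]
    rw [integral_sub (integrable_const _) ((continuous_wordLoopZd_update ρ hρ x w l U).integrable_of_hasCompactSupport
      (HasCompactSupport.of_compactSpace _)), integral_const, probReal_univ, one_smul,
      integral_haar_wordLoopZd_update_mul_eq_zero ρ hρ hρ0 x w hl U, sub_zero]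
  have h := hμ.le_exp_mul_integral_of_haarAvg_eq ρ hρ hS hfc hf0 l havg
  have hint : ∫ U, f U ∂μ = 1 - ∫ U, wordLoopZd ρ x w U ∂μ := by
    simp only [hf]
    rw [integral_sub (integrable_const _) (integrable_of_continuous_real hWc μ), integral_const, probReal_univ, one_smul]
  rw [hint] at h
  have hK := Real.exp_pos (|β| * (2 * N * (plaquettesTouching ({l} : Finset (ZdEdge d))).card))
  rw [Real.exp_neg, inv_le_iff_one_le_mul₀ hK]
  linarith [h]

/-- ★★★ **QUANTITATIVE UNFREEZING FOR LOOPS, LOWER SIDE**: `e^{−|β|·2N·#{p ∋ l}} ≤ 1 + ∫ W_x(w) dμ`. [folklore] -/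
theorem IsHaarShiftState.exp_le_one_add_integral_wordLoopZd (hρ : Continuous ρ)
    (hρ0 : ∀ m : G, ∫ g, ((ρ (g * m)).trace).re ∂(haarProbability G) = 0) {β : ℝ} {μ : Measure (LGConfig d G)}
    [IsProbabilityMeasure μ] (hμ : IsHaarShiftState ρ β μ) (x : Site d) (w : Word d) {l : ZdEdge d}
    (hl : (TiltedRP.Word.edgesRead (TiltedRP.zdUnit d) x w).count l = 1) :
    Real.exp (-(|β| * (2 * N * (plaquettesTouching ({l} : Finset (ZdEdge d))).card))) ≤ 1 + ∫ U, wordLoopZd ρ x w U ∂μ := by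
  set f : LGConfig d G → ℝ := fun U => 1 + wordLoopZd ρ x w U with hf
  obtain ⟨S, hS⟩ := isCylinder_one_add_wordLoopZd (G := G) ρ x w
  have hWc : Continuous (wordLoopZd ρ x w) := continuous_wordLoopZd hρ x w
  have hfc : Continuous f := continuous_const.add hWc
  have hf0 : ∀ U, 0 ≤ f U := fun U => by
    have h := (abs_le.1 (abs_wordLoopZd_le_one ρ hρ x w U)).1
    simp only [hf]; linarith
  have havg : ∀ U, ∫ g, f (Function.update U l (g * U l)) ∂(haarProbability G) = 1 := by
    intro U
    simp only [hf]
    rw [integral_add (integrable_const _) ((continuous_wordLoopZd_update ρ hρ x w l U).integrable_of_hasCompactSupport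
      (HasCompactSupport.of_compactSpace _)), integral_const, probReal_univ, one_smul,
      integral_haar_wordLoopZd_update_mul_eq_zero ρ hρ hρ0 x w hl U, add_zero]
  have h := hμ.le_exp_mul_integral_of_haarAvg_eq ρ hρ hS hfc hf0 l havg
  have hint : ∫ U, f U ∂μ = 1 + ∫ U, wordLoopZd ρ x w U ∂μ := by
    simp only [hf]
    rw [integral_add (integrable_const _) (integrable_of_continuous_real hWc μ), integral_const, probReal_univ, one_smul]
  rw [hint] at h
  have hK := Real.exp_pos (|β| * (2 * N * (plaquettesTouching ({l} : Finset (ZdEdge d))).card))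
  rw [Real.exp_neg, inv_le_iff_one_le_mul₀ hK]
  linarith [h]

end Gap

/-! ## `SU(N)`: every DLR state, every loop reading a link once, every real `β` -/

section SuN

/-- ★★★ **QUANTITATIVE UNFREEZING OF WILSON LOOPS IN `SU(N)` GIBBS STATES.**  `N ≥ 2`, any `d`, ANY real `β`, `μ ∈ 𝒢(β)` any DLR
state on `ℤ^d`, `x` any base point, `w` any word reading some link `l` exactly once (every self-avoiding lattice loop):
`e^{−4(d−1)N|β|} ≤ 1 − ∫ W_x(w) dμ`. [folklore] -/
theorem exp_le_one_sub_integral_wordLoopZd_of_mem_ymGibbsMeasures_suN {d N : ℕ} (hN : 2 ≤ N) {β : ℝ}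
    {μ : Measure (LGConfig d (Matrix.specialUnitaryGroup (Fin N) ℂ))}
    (hμ : μ ∈ ymGibbsMeasures (d := d) (fundamentalRep (Fin N)) β) (x : Site d) (w : Word d) {l : ZdEdge d}
    (hl : (TiltedRP.Word.edgesRead (TiltedRP.zdUnit d) x w).count l = 1) :
    Real.exp (-(4 * ((d - 1 : ℕ) : ℝ) * N * |β|)) ≤ 1 - ∫ U, wordLoopZd (fundamentalRep (Fin N)) x w U ∂μ := by
  haveI : SecondCountableTopology (Matrix (Fin N) (Fin N) ℂ) :=
    inferInstanceAs (SecondCountableTopology (Fin N → Fin N → ℂ))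
  haveI : SecondCountableTopology (Matrix.specialUnitaryGroup (Fin N) ℂ) :=
    Topology.IsEmbedding.subtypeVal.secondCountableTopology
  have hG : Literature.Probability.LatticeModels.IsGibbsMeasure (ymSpecification (fundamentalRep (Fin N)) β) μ := hμ
  haveI := hG.isProbabilityMeasure
  obtain ⟨z, ζ, hζ1, hz, -⟩ :=
    Literature.MathematicalPhysics.QuantumFieldTheory.IsSpecialUnitaryModel.exists_central (fundamentalRep (Fin N))
      (Literature.MathematicalPhysics.QuantumFieldTheory.TorusAreaLaw.isSpecialUnitaryModel_fundamentalRep N) hN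
  have hρ0 := integral_re_trace_mul_eq_zero_of_smul_one (fundamentalRep (Fin N)) (continuous_fundamentalRep (Fin N)) hz hζ1
  have h := (isHaarShiftState_of_mem_ymGibbsMeasures (fundamentalRep (Fin N)) (continuous_fundamentalRep _) hμ)
    |>.exp_le_one_sub_integral_wordLoopZd (fundamentalRep (Fin N)) (continuous_fundamentalRep _) hρ0 x w hl
  rwa [shiftExponent_eq] at h

/-- The lower side. [folklore] -/
theorem exp_le_one_add_integral_wordLoopZd_of_mem_ymGibbsMeasures_suN {d N : ℕ} (hN : 2 ≤ N) {β : ℝ}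
    {μ : Measure (LGConfig d (Matrix.specialUnitaryGroup (Fin N) ℂ))}
    (hμ : μ ∈ ymGibbsMeasures (d := d) (fundamentalRep (Fin N)) β) (x : Site d) (w : Word d) {l : ZdEdge d}
    (hl : (TiltedRP.Word.edgesRead (TiltedRP.zdUnit d) x w).count l = 1) :
    Real.exp (-(4 * ((d - 1 : ℕ) : ℝ) * N * |β|)) ≤ 1 + ∫ U, wordLoopZd (fundamentalRep (Fin N)) x w U ∂μ := by
  haveI : SecondCountableTopology (Matrix (Fin N) (Fin N) ℂ) :=
    inferInstanceAs (SecondCountableTopology (Fin N → Fin N → ℂ))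
  haveI : SecondCountableTopology (Matrix.specialUnitaryGroup (Fin N) ℂ) :=
    Topology.IsEmbedding.subtypeVal.secondCountableTopology
  have hG : Literature.Probability.LatticeModels.IsGibbsMeasure (ymSpecification (fundamentalRep (Fin N)) β) μ := hμ
  haveI := hG.isProbabilityMeasure
  obtain ⟨z, ζ, hζ1, hz, -⟩ :=
    Literature.MathematicalPhysics.QuantumFieldTheory.IsSpecialUnitaryModel.exists_central (fundamentalRep (Fin N))
      (Literature.MathematicalPhysics.QuantumFieldTheory.TorusAreaLaw.isSpecialUnitaryModel_fundamentalRep N) hN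
  have hρ0 := integral_re_trace_mul_eq_zero_of_smul_one (fundamentalRep (Fin N)) (continuous_fundamentalRep (Fin N)) hz hζ1
  have h := (isHaarShiftState_of_mem_ymGibbsMeasures (fundamentalRep (Fin N)) (continuous_fundamentalRep _) hμ)
    |>.exp_le_one_add_integral_wordLoopZd (fundamentalRep (Fin N)) (continuous_fundamentalRep _) hρ0 x w hl
  rwa [shiftExponent_eq] at h

/-- ★★★ Two-sided: `|∫ W_x(w) dμ| ≤ 1 − e^{−4(d−1)N|β|}` for every DLR state of `SU(N)`, every real `β` and every word reading a
link exactly once. [folklore] -/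
theorem abs_integral_wordLoopZd_le_of_mem_ymGibbsMeasures_suN {d N : ℕ} (hN : 2 ≤ N) {β : ℝ}
    {μ : Measure (LGConfig d (Matrix.specialUnitaryGroup (Fin N) ℂ))}
    (hμ : μ ∈ ymGibbsMeasures (d := d) (fundamentalRep (Fin N)) β) (x : Site d) (w : Word d) {l : ZdEdge d}
    (hl : (TiltedRP.Word.edgesRead (TiltedRP.zdUnit d) x w).count l = 1) :
    |∫ U, wordLoopZd (fundamentalRep (Fin N)) x w U ∂μ| ≤ 1 - Real.exp (-(4 * ((d - 1 : ℕ) : ℝ) * N * |β|)) := by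
  have h1 := exp_le_one_sub_integral_wordLoopZd_of_mem_ymGibbsMeasures_suN hN hμ x w hl
  have h2 := exp_le_one_add_integral_wordLoopZd_of_mem_ymGibbsMeasures_suN hN hμ x w hl
  rw [abs_le]
  constructor <;> linarith

/-- Example: the plaquette word `+e_a +e_ν −e_a −e_ν` (`a ≠ ν`) reads its first link `(x, a)` exactly once on `ℤ^d`. [folklore] -/
theorem count_edgesRead_plaquette_fst {d : ℕ} (x : Site d) {a ν : Fin d} (haν : a ≠ ν) :
    (TiltedRP.Word.edgesRead (TiltedRP.zdUnit d) x (Word.plaquette a ν)).count (x, a) = 1 := by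
  rw [TiltedRP.Word.edgesRead_plaquette]
  have h4 : ((x, ν) : ZdEdge d) ≠ (x, a) := fun h => haν.symm (Prod.mk.inj h).2
  simp [h4]

end SuN

end Summit.QuantumFields.GaugeBoot

end
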